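import Summits.BirchSwinnertonDyer.BirchSwinnertonDyer.Theorems.BiquadraticEisensteinDescentHeegnerTwistCouplingInSupplySignTableDoor
import HarnessLib

set_option linter.dupNamespace false -- `Summit.BirchSwinnertonDyer.BirchSwinnertonDyer.Theorems.…` (summit = sub)
set_option autoImplicit false

/-!
# Crux `HeegnerTwistCouplingInSupply` (stmt-BirchSwinnertonDyer-21381) — PATTERN-FREE doors for the two-parameter congruent
# families `E_{pr}`, `E_{2pr}`: a winning family that wins for EVERY mutual symbol needs only one located prime per slot

Route `BiquadraticEisensteinDescent` (cell `pub/bsd-wall`, width seat `bsd-wall-cm-bed-w3` g19; `--supports` 21381, helper).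
w3 g18's sign-table engine (`…SymbolicMonskyDefs`, `…SignTableDoor`) proves: a WINNING recipe (cells, signs `(q_i/p)`, mutual symbols
`(q_j/q_i)`) REALISED by actual primes, with `√(q₁⋯q_t)·log(q₁⋯q_t) < πp`, gives the conclusion of crux 21381 for `W = E_{pr}` /
`E_{2pr}` modulo Burungale–Tian only (`Recipe.RealisesK1.cruxOnEpr_of_BT` / `cruxOnE2pr_of_BT`). Its open input is the SUPPLY of
realising primes — including the MUTUAL symbols, a bilinear condition. Observation of this seat (solver on g18's engine, then
kernel-checked per family by `decide` in `…LinnikCensusKOne`): every k = 1 configuration admits a **pattern-free** family — `t = 2` or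
`t = 3` DISTINCT cells with fixed signs such that the recipe wins for EVERY assignment of the mutual symbols. For such a family the
supply is `t` INDEPENDENT single-prime conditions «`q_i` prime, `q_i ≡ c_i (8)`, `(q_i/r) = e_i`, `(q_i/p) = s_i`», no bilinear input.
This file turns that observation into doors:

* `realisesK1_two` / `realisesK1_three` — from plain hypotheses on primes `p, r, q₀, q₁ (, q₂)` build `RealisesK1` for the recipe
  whose mutual-symbol bits are READ OFF the actual primes (`decide (J(q_j|q_i) = −1)`);
* ★ `cruxOnEpr_of_patternFree_two_of_BT` / `…_three_…` (odd base `E_{pr}`) and ★ `cruxOnE2pr_of_patternFree_two_of_BT` /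
  `…_three_…` (even base `E_{2pr}`): given a pattern-free winning family (hypothesis `hwin : ∀ mutual bits, winsPR … = true`,
  decidable per instance) and one located prime per slot with `√(∏q)·log(∏q) < πp`, the conclusion of crux 21381 for
  `W = E_{pr}` / `E_{2pr}`, modulo Burungale–Tian ONLY.

HONEST FRAMING: door lemmas; the census that supplies the slot primes for almost all `p` is `…LinnikCensusSlot` + `…LinnikCensusKOne`;
rung-level (congruent two-parameter families); the crux as stated (C⁺), its stubs and BSD are untouched. THEOREMS ONLY (no `def`).
-/

namespace Summit.BirchSwinnertonDyer.BirchSwinnertonDyer.Theorems.SymbolicMonsky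

open Literature.NumberTheory.EllipticCurves

section PatternFree

variable {pc rc : Fin 4} {rp : Bool}

/-! ## Realisation from plain data, `t = 2` -/

/-- **`RealisesK1` for a two-slot recipe whose mutual bit is read off the primes.** [folklore] -/
theorem realisesK1_two (c0 c1 : Fin 4 × Bool) (s0 s1 : Bool) {p r q0 q1 : ℕ}
    (hp : p.Prime) (hr : r.Prime) (hq0 : q0.Prime) (hq1 : q1.Prime)
    (hpm : p % 8 = clsVal pc) (hrm : r % 8 = clsVal rc)
    (hq0m : q0 % 8 = clsVal c0.1) (hq1m : q1 % 8 = clsVal c1.1)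
    (hpr : p ≠ r) (hq0p : q0 ≠ p) (hq1p : q1 ≠ p) (hq0r : q0 ≠ r) (hq1r : q1 ≠ r) (h01 : q0 ≠ q1)
    (hrp : jacobiSym (r : ℤ) p = -1 ↔ rp = true)
    (hs0 : jacobiSym (q0 : ℤ) p = -1 ↔ s0 = true) (hs1 : jacobiSym (q1 : ℤ) p = -1 ↔ s1 = true)
    (he0 : jacobiSym (q0 : ℤ) r = -1 ↔ c0.2 = true) (he1 : jacobiSym (q1 : ℤ) r = -1 ↔ c1.2 = true) :
    (⟨[c0, c1], [s0, s1], [[decide (jacobiSym (q1 : ℤ) q0 = -1)]]⟩ : Recipe).RealisesK1 pc rc rp p r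
      (fun i => if i.val = 0 then q0 else q1) := by
  refine ⟨hp, hr, ?_, hpm, hrm, ?_, hpr, ?_, ?_, ?_, hrp, ?_, ?_, ?_⟩
  · rintro ⟨i, hi⟩
    have hi2 : i < 2 := hi
    interval_cases i <;> simpa
  · rintro ⟨i, hi⟩
    have hi2 : i < 2 := hi
    interval_cases i
    · simpa [Recipe.cell] using hq0m
    · simpa [Recipe.cell] using hq1m
  · rintro ⟨i, hi⟩
    have hi2 : i < 2 := hi
    interval_cases i <;> simpa
  · rintro ⟨i, hi⟩
    have hi2 : i < 2 := hi
    interval_cases i <;> simpa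
  · rintro ⟨i, hi⟩ ⟨j, hj⟩ h
    have hi2 : i < 2 := hi
    have hj2 : j < 2 := hj
    simp only at h
    apply Fin.ext
    interval_cases i <;> interval_cases j <;> simp_all
  · rintro ⟨i, hi⟩
    have hi2 : i < 2 := hi
    interval_cases i
    · simpa [Recipe.sign] using hs0
    · simpa [Recipe.sign] using hs1
  · rintro ⟨i, hi⟩
    have hi2 : i < 2 := hi
    interval_cases i
    · simpa [Recipe.cell] using he0
    · simpa [Recipe.cell] using he1
  · rintro ⟨i, hi⟩ ⟨j, hj⟩ hij
    have hi2 : i < 2 := hi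
    have hj2 : j < 2 := hj
    have hij' : i < j := hij
    interval_cases i
    · interval_cases j
      simp [Recipe.qsym]
    · interval_cases j

/-! ## Realisation from plain data, `t = 3` -/

/-- **`RealisesK1` for a three-slot recipe whose three mutual bits are read off the primes.** [folklore] -/
theorem realisesK1_three (c0 c1 c2 : Fin 4 × Bool) (s0 s1 s2 : Bool) {p r q0 q1 q2 : ℕ}
    (hp : p.Prime) (hr : r.Prime) (hq0 : q0.Prime) (hq1 : q1.Prime) (hq2 : q2.Prime)
    (hpm : p % 8 = clsVal pc) (hrm : r % 8 = clsVal rc)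
    (hq0m : q0 % 8 = clsVal c0.1) (hq1m : q1 % 8 = clsVal c1.1) (hq2m : q2 % 8 = clsVal c2.1)
    (hpr : p ≠ r) (hq0p : q0 ≠ p) (hq1p : q1 ≠ p) (hq2p : q2 ≠ p) (hq0r : q0 ≠ r) (hq1r : q1 ≠ r) (hq2r : q2 ≠ r)
    (h01 : q0 ≠ q1) (h02 : q0 ≠ q2) (h12 : q1 ≠ q2)
    (hrp : jacobiSym (r : ℤ) p = -1 ↔ rp = true)
    (hs0 : jacobiSym (q0 : ℤ) p = -1 ↔ s0 = true) (hs1 : jacobiSym (q1 : ℤ) p = -1 ↔ s1 = true)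
    (hs2 : jacobiSym (q2 : ℤ) p = -1 ↔ s2 = true)
    (he0 : jacobiSym (q0 : ℤ) r = -1 ↔ c0.2 = true) (he1 : jacobiSym (q1 : ℤ) r = -1 ↔ c1.2 = true)
    (he2 : jacobiSym (q2 : ℤ) r = -1 ↔ c2.2 = true) :
    (⟨[c0, c1, c2], [s0, s1, s2],
        [[decide (jacobiSym (q1 : ℤ) q0 = -1), decide (jacobiSym (q2 : ℤ) q0 = -1)],
          [decide (jacobiSym (q2 : ℤ) q1 = -1)]]⟩ : Recipe).RealisesK1 pc rc rp p r
      (fun i => if i.val = 0 then q0 else if i.val = 1 then q1 else q2) := by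
  refine ⟨hp, hr, ?_, hpm, hrm, ?_, hpr, ?_, ?_, ?_, hrp, ?_, ?_, ?_⟩
  · rintro ⟨i, hi⟩
    have hi3 : i < 3 := hi
    interval_cases i <;> simpa
  · rintro ⟨i, hi⟩
    have hi3 : i < 3 := hi
    interval_cases i
    · simpa [Recipe.cell] using hq0m
    · simpa [Recipe.cell] using hq1m
    · simpa [Recipe.cell] using hq2m
  · rintro ⟨i, hi⟩
    have hi3 : i < 3 := hi
    interval_cases i <;> simpa
  · rintro ⟨i, hi⟩
    have hi3 : i < 3 := hi
    interval_cases i <;> simpa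
  · rintro ⟨i, hi⟩ ⟨j, hj⟩ h
    have hi3 : i < 3 := hi
    have hj3 : j < 3 := hj
    simp only at h
    apply Fin.ext
    interval_cases i <;> interval_cases j <;> simp_all
  · rintro ⟨i, hi⟩
    have hi3 : i < 3 := hi
    interval_cases i
    · simpa [Recipe.sign] using hs0
    · simpa [Recipe.sign] using hs1
    · simpa [Recipe.sign] using hs2
  · rintro ⟨i, hi⟩
    have hi3 : i < 3 := hi
    interval_cases i
    · simpa [Recipe.cell] using he0
    · simpa [Recipe.cell] using he1
    · simpa [Recipe.cell] using he2
  · rintro ⟨i, hi⟩ ⟨j, hj⟩ hij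
    have hi3 : i < 3 := hi
    have hj3 : j < 3 := hj
    have hij' : i < j := hij
    interval_cases i
    · interval_cases j <;> simp [Recipe.qsym]
    · interval_cases j
      simp [Recipe.qsym]
    · interval_cases j

/-! ## The pattern-free doors -/

namespace Recipe.RealisesK1

/-- ★ **Pattern-free door, odd base `E_{pr}`, two slots**: if the two-slot recipe with cells `c₀, c₁` and signs `s₀, s₁` WINS FOR BOTH
values of the mutual symbol (`hwin`, decidable per instance), then any primes `p ≡ pc`, `r ≡ rc (mod 8)` with `[(r/p) = −1] = rp` and
located primes `q₀ ≠ q₁` in the slots (`qᵢ ≡ cᵢ.1 (mod 8)`, `[(qᵢ/r) = −1] = cᵢ.2`, `[(qᵢ/p) = −1] = sᵢ`, `qᵢ ∉ {p, r}`) with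
`√(q₀q₁)·log(q₀q₁) < πp` give the conclusion of crux 21381 for `W = E_{pr}`, modulo Burungale–Tian only.
[cite: BurungaleTian2026, Thm. 1.1] [cite: HeathBrown1994SelmerCongruentII, Appendix (Monsky), typescript p. 39 L27–L33]
[cite: Oesterle1988Gauss, II §3 Proposition p. 57 (27)] -/
theorem cruxOnEpr_of_patternFree_two_of_BT
    (hBT : burungaleTian_analyticRank_eq_zero_of_selmerCorank_eq_zero_of_hasCM)
    (c0 c1 : Fin 4 × Bool) (s0 s1 : Bool)
    (hwin : ∀ b : Bool, (⟨[c0, c1], [s0, s1], [[b]]⟩ : Recipe).winsPR pc rc rp = true)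
    {p r q0 q1 : ℕ} (hp : p.Prime) (hr : r.Prime) (hq0 : q0.Prime) (hq1 : q1.Prime)
    (hpm : p % 8 = clsVal pc) (hrm : r % 8 = clsVal rc)
    (hq0m : q0 % 8 = clsVal c0.1) (hq1m : q1 % 8 = clsVal c1.1)
    (hpr : p ≠ r) (hq0p : q0 ≠ p) (hq1p : q1 ≠ p) (hq0r : q0 ≠ r) (hq1r : q1 ≠ r) (h01 : q0 ≠ q1)
    (hrp : jacobiSym (r : ℤ) p = -1 ↔ rp = true)
    (hs0 : jacobiSym (q0 : ℤ) p = -1 ↔ s0 = true) (hs1 : jacobiSym (q1 : ℤ) p = -1 ↔ s1 = true)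
    (he0 : jacobiSym (q0 : ℤ) r = -1 ↔ c0.2 = true) (he1 : jacobiSym (q1 : ℤ) r = -1 ↔ c1.2 = true)
    (hsize : Real.sqrt ((q0 * q1 : ℕ) : ℝ) * Real.log ((q0 * q1 : ℕ) : ℝ) < Real.pi * p) :
    ∃ (K : Type) (_ : Field K) (_ : NumberField K),
      IsImaginaryQuadratic K ∧ 4 < (NumberField.discr K).natAbs ∧
      SatisfiesHeegnerHypothesis ((congruentNumberCurve (p * r)).conductorNorm ℤ) K ∧
      ((congruentNumberCurve (p * r)).quadraticTwist (NumberField.discr K : ℚ)).entireLFunction 1 ≠ 0 ∧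
      ¬ p ∣ NumberField.classNumber K := by
  haveI := isElliptic_congruentNumberCurve (Nat.mul_ne_zero hp.ne_zero hr.ne_zero)
  have hR := realisesK1_two (pc := pc) (rc := rc) (rp := rp) c0 c1 s0 s1 hp hr hq0 hq1 hpm hrm hq0m hq1m hpr hq0p hq1p
    hq0r hq1r h01 hrp hs0 hs1 he0 he1
  have hprod : (∏ i, (fun i : Fin (⟨[c0, c1], [s0, s1], [[decide (jacobiSym (q1 : ℤ) q0 = -1)]]⟩ : Recipe).t =>
      if i.val = 0 then q0 else q1) i) = q0 * q1 := by
    rw [show (⟨[c0, c1], [s0, s1], [[decide (jacobiSym (q1 : ℤ) q0 = -1)]]⟩ : Recipe).t = 2 from rfl,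
      Fin.prod_univ_two]
    simp
  exact hR.cruxOnEpr_of_BT hBT (hwin _) (by rw [hprod]; exact hsize)

/-- ★ **Pattern-free door, even base `E_{2pr}`, two slots** (same, with `wins2PR` and `W = E_{2pr}`).
[cite: BurungaleTian2026, Thm. 1.1] [cite: HeathBrown1994SelmerCongruentII, Appendix (Monsky), typescript p. 41 L20–L36] -/
theorem cruxOnE2pr_of_patternFree_two_of_BT
    (hBT : burungaleTian_analyticRank_eq_zero_of_selmerCorank_eq_zero_of_hasCM)
    (c0 c1 : Fin 4 × Bool) (s0 s1 : Bool)
    (hwin : ∀ b : Bool, (⟨[c0, c1], [s0, s1], [[b]]⟩ : Recipe).wins2PR pc rc rp = true)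
    {p r q0 q1 : ℕ} (hp : p.Prime) (hr : r.Prime) (hq0 : q0.Prime) (hq1 : q1.Prime)
    (hpm : p % 8 = clsVal pc) (hrm : r % 8 = clsVal rc)
    (hq0m : q0 % 8 = clsVal c0.1) (hq1m : q1 % 8 = clsVal c1.1)
    (hpr : p ≠ r) (hq0p : q0 ≠ p) (hq1p : q1 ≠ p) (hq0r : q0 ≠ r) (hq1r : q1 ≠ r) (h01 : q0 ≠ q1)
    (hrp : jacobiSym (r : ℤ) p = -1 ↔ rp = true)
    (hs0 : jacobiSym (q0 : ℤ) p = -1 ↔ s0 = true) (hs1 : jacobiSym (q1 : ℤ) p = -1 ↔ s1 = true)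
    (he0 : jacobiSym (q0 : ℤ) r = -1 ↔ c0.2 = true) (he1 : jacobiSym (q1 : ℤ) r = -1 ↔ c1.2 = true)
    (hsize : Real.sqrt ((q0 * q1 : ℕ) : ℝ) * Real.log ((q0 * q1 : ℕ) : ℝ) < Real.pi * p) :
    ∃ (K : Type) (_ : Field K) (_ : NumberField K),
      IsImaginaryQuadratic K ∧ 4 < (NumberField.discr K).natAbs ∧
      SatisfiesHeegnerHypothesis ((congruentNumberCurve (2 * (p * r))).conductorNorm ℤ) K ∧
      ((congruentNumberCurve (2 * (p * r))).quadraticTwist (NumberField.discr K : ℚ)).entireLFunction 1 ≠ 0 ∧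
      ¬ p ∣ NumberField.classNumber K := by
  haveI := isElliptic_congruentNumberCurve (Nat.mul_ne_zero two_ne_zero (Nat.mul_ne_zero hp.ne_zero hr.ne_zero))
  have hR := realisesK1_two (pc := pc) (rc := rc) (rp := rp) c0 c1 s0 s1 hp hr hq0 hq1 hpm hrm hq0m hq1m hpr hq0p hq1p
    hq0r hq1r h01 hrp hs0 hs1 he0 he1
  have hprod : (∏ i, (fun i : Fin (⟨[c0, c1], [s0, s1], [[decide (jacobiSym (q1 : ℤ) q0 = -1)]]⟩ : Recipe).t =>
      if i.val = 0 then q0 else q1) i) = q0 * q1 := by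
    rw [show (⟨[c0, c1], [s0, s1], [[decide (jacobiSym (q1 : ℤ) q0 = -1)]]⟩ : Recipe).t = 2 from rfl,
      Fin.prod_univ_two]
    simp
  exact hR.cruxOnE2pr_of_BT hBT (hwin _) (by rw [hprod]; exact hsize)

/-- ★ **Pattern-free door, odd base `E_{pr}`, three slots**: the three-slot recipe wins for ALL EIGHT mutual patterns (`hwin`); three
located primes (distinct, in the slots, with the slot signs) with `√(q₀q₁q₂)·log(q₀q₁q₂) < πp` give the conclusion of crux 21381 for
`W = E_{pr}`, modulo Burungale–Tian only. [cite: BurungaleTian2026, Thm. 1.1]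
[cite: HeathBrown1994SelmerCongruentII, Appendix (Monsky), typescript p. 39 L27–L33] -/
theorem cruxOnEpr_of_patternFree_three_of_BT
    (hBT : burungaleTian_analyticRank_eq_zero_of_selmerCorank_eq_zero_of_hasCM)
    (c0 c1 c2 : Fin 4 × Bool) (s0 s1 s2 : Bool)
    (hwin : ∀ b01 b02 b12 : Bool,
      (⟨[c0, c1, c2], [s0, s1, s2], [[b01, b02], [b12]]⟩ : Recipe).winsPR pc rc rp = true)
    {p r q0 q1 q2 : ℕ} (hp : p.Prime) (hr : r.Prime) (hq0 : q0.Prime) (hq1 : q1.Prime) (hq2 : q2.Prime)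
    (hpm : p % 8 = clsVal pc) (hrm : r % 8 = clsVal rc)
    (hq0m : q0 % 8 = clsVal c0.1) (hq1m : q1 % 8 = clsVal c1.1) (hq2m : q2 % 8 = clsVal c2.1)
    (hpr : p ≠ r) (hq0p : q0 ≠ p) (hq1p : q1 ≠ p) (hq2p : q2 ≠ p) (hq0r : q0 ≠ r) (hq1r : q1 ≠ r) (hq2r : q2 ≠ r)
    (h01 : q0 ≠ q1) (h02 : q0 ≠ q2) (h12 : q1 ≠ q2)
    (hrp : jacobiSym (r : ℤ) p = -1 ↔ rp = true)
    (hs0 : jacobiSym (q0 : ℤ) p = -1 ↔ s0 = true) (hs1 : jacobiSym (q1 : ℤ) p = -1 ↔ s1 = true)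
    (hs2 : jacobiSym (q2 : ℤ) p = -1 ↔ s2 = true)
    (he0 : jacobiSym (q0 : ℤ) r = -1 ↔ c0.2 = true) (he1 : jacobiSym (q1 : ℤ) r = -1 ↔ c1.2 = true)
    (he2 : jacobiSym (q2 : ℤ) r = -1 ↔ c2.2 = true)
    (hsize : Real.sqrt ((q0 * q1 * q2 : ℕ) : ℝ) * Real.log ((q0 * q1 * q2 : ℕ) : ℝ) < Real.pi * p) :
    ∃ (K : Type) (_ : Field K) (_ : NumberField K),
      IsImaginaryQuadratic K ∧ 4 < (NumberField.discr K).natAbs ∧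
      SatisfiesHeegnerHypothesis ((congruentNumberCurve (p * r)).conductorNorm ℤ) K ∧
      ((congruentNumberCurve (p * r)).quadraticTwist (NumberField.discr K : ℚ)).entireLFunction 1 ≠ 0 ∧
      ¬ p ∣ NumberField.classNumber K := by
  haveI := isElliptic_congruentNumberCurve (Nat.mul_ne_zero hp.ne_zero hr.ne_zero)
  have hR := realisesK1_three (pc := pc) (rc := rc) (rp := rp) c0 c1 c2 s0 s1 s2 hp hr hq0 hq1 hq2 hpm hrm hq0m hq1m hq2m
    hpr hq0p hq1p hq2p hq0r hq1r hq2r h01 h02 h12 hrp hs0 hs1 hs2 he0 he1 he2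
  have hprod : (∏ i, (fun i : Fin (⟨[c0, c1, c2], [s0, s1, s2],
      [[decide (jacobiSym (q1 : ℤ) q0 = -1), decide (jacobiSym (q2 : ℤ) q0 = -1)],
        [decide (jacobiSym (q2 : ℤ) q1 = -1)]]⟩ : Recipe).t =>
      if i.val = 0 then q0 else if i.val = 1 then q1 else q2) i) = q0 * q1 * q2 := by
    rw [show (⟨[c0, c1, c2], [s0, s1, s2],
      [[decide (jacobiSym (q1 : ℤ) q0 = -1), decide (jacobiSym (q2 : ℤ) q0 = -1)],
        [decide (jacobiSym (q2 : ℤ) q1 = -1)]]⟩ : Recipe).t = 3 from rfl, Fin.prod_univ_three]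
    simp [mul_assoc]
  exact hR.cruxOnEpr_of_BT hBT (hwin _ _ _) (by rw [hprod]; exact hsize)

/-- ★ **Pattern-free door, even base `E_{2pr}`, three slots.** [cite: BurungaleTian2026, Thm. 1.1]
[cite: HeathBrown1994SelmerCongruentII, Appendix (Monsky), typescript p. 41 L20–L36] -/
theorem cruxOnE2pr_of_patternFree_three_of_BT
    (hBT : burungaleTian_analyticRank_eq_zero_of_selmerCorank_eq_zero_of_hasCM)
    (c0 c1 c2 : Fin 4 × Bool) (s0 s1 s2 : Bool)
    (hwin : ∀ b01 b02 b12 : Bool,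
      (⟨[c0, c1, c2], [s0, s1, s2], [[b01, b02], [b12]]⟩ : Recipe).wins2PR pc rc rp = true)
    {p r q0 q1 q2 : ℕ} (hp : p.Prime) (hr : r.Prime) (hq0 : q0.Prime) (hq1 : q1.Prime) (hq2 : q2.Prime)
    (hpm : p % 8 = clsVal pc) (hrm : r % 8 = clsVal rc)
    (hq0m : q0 % 8 = clsVal c0.1) (hq1m : q1 % 8 = clsVal c1.1) (hq2m : q2 % 8 = clsVal c2.1)
    (hpr : p ≠ r) (hq0p : q0 ≠ p) (hq1p : q1 ≠ p) (hq2p : q2 ≠ p) (hq0r : q0 ≠ r) (hq1r : q1 ≠ r) (hq2r : q2 ≠ r)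
    (h01 : q0 ≠ q1) (h02 : q0 ≠ q2) (h12 : q1 ≠ q2)
    (hrp : jacobiSym (r : ℤ) p = -1 ↔ rp = true)
    (hs0 : jacobiSym (q0 : ℤ) p = -1 ↔ s0 = true) (hs1 : jacobiSym (q1 : ℤ) p = -1 ↔ s1 = true)
    (hs2 : jacobiSym (q2 : ℤ) p = -1 ↔ s2 = true)
    (he0 : jacobiSym (q0 : ℤ) r = -1 ↔ c0.2 = true) (he1 : jacobiSym (q1 : ℤ) r = -1 ↔ c1.2 = true)
    (he2 : jacobiSym (q2 : ℤ) r = -1 ↔ c2.2 = true)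
    (hsize : Real.sqrt ((q0 * q1 * q2 : ℕ) : ℝ) * Real.log ((q0 * q1 * q2 : ℕ) : ℝ) < Real.pi * p) :
    ∃ (K : Type) (_ : Field K) (_ : NumberField K),
      IsImaginaryQuadratic K ∧ 4 < (NumberField.discr K).natAbs ∧
      SatisfiesHeegnerHypothesis ((congruentNumberCurve (2 * (p * r))).conductorNorm ℤ) K ∧
      ((congruentNumberCurve (2 * (p * r))).quadraticTwist (NumberField.discr K : ℚ)).entireLFunction 1 ≠ 0 ∧
      ¬ p ∣ NumberField.classNumber K := by
  haveI := isElliptic_congruentNumberCurve (Nat.mul_ne_zero two_ne_zero (Nat.mul_ne_zero hp.ne_zero hr.ne_zero))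
  have hR := realisesK1_three (pc := pc) (rc := rc) (rp := rp) c0 c1 c2 s0 s1 s2 hp hr hq0 hq1 hq2 hpm hrm hq0m hq1m hq2m
    hpr hq0p hq1p hq2p hq0r hq1r hq2r h01 h02 h12 hrp hs0 hs1 hs2 he0 he1 he2
  have hprod : (∏ i, (fun i : Fin (⟨[c0, c1, c2], [s0, s1, s2],
      [[decide (jacobiSym (q1 : ℤ) q0 = -1), decide (jacobiSym (q2 : ℤ) q0 = -1)],
        [decide (jacobiSym (q2 : ℤ) q1 = -1)]]⟩ : Recipe).t =>
      if i.val = 0 then q0 else if i.val = 1 then q1 else q2) i) = q0 * q1 * q2 := by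
    rw [show (⟨[c0, c1, c2], [s0, s1, s2],
      [[decide (jacobiSym (q1 : ℤ) q0 = -1), decide (jacobiSym (q2 : ℤ) q0 = -1)],
        [decide (jacobiSym (q2 : ℤ) q1 = -1)]]⟩ : Recipe).t = 3 from rfl, Fin.prod_univ_three]
    simp [mul_assoc]
  exact hR.cruxOnE2pr_of_BT hBT (hwin _ _ _) (by rw [hprod]; exact hsize)

end Recipe.RealisesK1

end PatternFree

end Summit.BirchSwinnertonDyer.BirchSwinnertonDyer.Theorems.SymbolicMonsky
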